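import Summits.Ventures.PercRepro.C041ZoneZMarks

/-!
# THEOREM Z (the ZONE LEMMA of C-041.md §12) — the abstract model and its three involutions (p6, gen 27;
mine-3's LEAN SHEET C-041.md §12 (k), reformulated without fibres)

The ABSTRACT ZONE: a vertex type `V`, an edge type `E` with two end maps (`fst`, `snd`; parallel edges and loops
allowed), terminal edges `T₁` / `T₂` (the `1`- and `2`-edges) with their vertex maps `at₁` / `at₂` (`ZoneData`).
A STATE is a triple of colourings `(col, τ₁, τ₂)` (`State`; `true` = red).  Red / blue adjacency, the MIXED adjacency
relative to a protected vertex set `P` (a blue edge not touching `P`, or a red edge touching `P`), the reach of a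
vertex set along an adjacency (`reach`, `reachIn`), the MARKS `Bl` / `Blt` / `M` / `Mt` (a blue / red `1`-edge, a
blue / red `2`-edge at the vertex), and the zone sets of §12 with a PROTECTED anchor set `Q` (`Q = ∅` is the plain
lemma, `Q = {c}` the `c`-variant): `P Q σ` = the blue reach of `Q`, `Gam` = «the sub-zones of `Q` carry no blue
terminal edge», `D` = the deleted vertices, `K`, `REACH`, `adm`, `blueK`, `anchorDel`, `reach2`, and the finite sets
`Lset`, `Rset` (𝓛_Z, 𝓡_Z), `Kset`, `Pset` (the forcing form), `W`, `K2`, `P2` (the images of the steps).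

The THREE INVOLUTIONS: `flipCol X` complements the colours of the edges NOT touching `X`; `swapMark X` (module
`C041ZoneZMarks`) exchanges the two constant colourings (all-red ↔ all-blue) of the `1`-edges at every vertex outside
`X` and fixes every mixed colouring; `flipOut X σ` / `dual X σ` are the induced maps on states (`dual` = both).  Proved
here: `flipCol` is an involution (`flipCol_flipCol`), hence `flipOut_flipOut`, `dual_dual` and the injectivity of
both maps; the colour of an edge under the maps (`dual_fst_of_touches`, `dual_fst_of_not_touches`, …); and the marks
of the images (`mem_Bl_dual_of_mem`, `mem_Bl_dual_of_not_mem`, …: inside `X` unchanged, outside `X` the blue and the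
red `1`-marks are exchanged, the `2`-marks never change).  The reach lemmas and the three steps are the next modules.
-/

namespace PercRepro

namespace ZoneZ

open Finset

/-- The data of an abstract zone: the two ends of every edge, the vertex of every `1`-edge and of every `2`-edge. -/
structure ZoneData (V E T₁ T₂ : Type*) where
  /-- the first end of an edge -/
  fst : E → V
  /-- the second end of an edge -/
  snd : E → V
  /-- the vertex of a `1`-edge -/
  at₁ : T₁ → V
  /-- the vertex of a `2`-edge -/
  at₂ : T₂ → V

/-- A state: the colours of the edges and of the `1`- and `2`-edges (`true` = red). -/
abbrev State (E T₁ T₂ : Type*) := (E → Bool) × (T₁ → Bool) × (T₂ → Bool)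

variable {V E T₁ T₂ : Type*}

namespace ZoneData

variable (Z : ZoneData V E T₁ T₂)

/-! ## Edges, adjacencies, reaches -/

/-- The edge `e` joins `u` and `v`. -/
def Joins (e : E) (u v : V) : Prop := (Z.fst e = u ∧ Z.snd e = v) ∨ (Z.fst e = v ∧ Z.snd e = u)

/-- The edge `e` has an end in `X`. -/
def Touches (X : Set V) (e : E) : Prop := Z.fst e ∈ X ∨ Z.snd e ∈ X

/-- Adjacency through an edge whose colour satisfies `cond`. -/
def Adj (cond : E → Bool → Prop) (σ : State E T₁ T₂) (u v : V) : Prop := ∃ e, Z.Joins e u v ∧ cond e (σ.1 e)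

/-- Red adjacency. -/
def RedAdj (σ : State E T₁ T₂) : V → V → Prop := Z.Adj (fun _ b => b = true) σ

/-- Blue adjacency. -/
def BlueAdj (σ : State E T₁ T₂) : V → V → Prop := Z.Adj (fun _ b => b = false) σ

/-- The MIXED adjacency relative to the protected set `P`: a blue edge not touching `P`, or a red edge touching `P`. -/
def MixedAdj (P : Set V) (σ : State E T₁ T₂) : V → V → Prop :=
  Z.Adj (fun e b => (Z.Touches P e ∧ b = true) ∨ (¬ Z.Touches P e ∧ b = false)) σ

/-- The vertices reachable from `S` along `R`. -/
def reach (R : V → V → Prop) (S : Set V) : Set V := {v | ∃ s ∈ S, Relation.ReflTransGen R s v}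

/-- The vertices reachable from `S ∩ U` along `R` inside `U`. -/
def reachIn (R : V → V → Prop) (U S : Set V) : Set V :=
  reach (fun x y => R x y ∧ x ∈ U ∧ y ∈ U) (S ∩ U)

/-! ## Marks -/

/-- `Bl`: the vertices with a blue `1`-edge (the BLOCKERS). -/
def Bl (σ : State E T₁ T₂) : Set V := markSet Z.at₁ σ.2.1 false

/-- `Blt`: the vertices with a red `1`-edge. -/
def Blt (σ : State E T₁ T₂) : Set V := markSet Z.at₁ σ.2.1 true

/-- `M`: the vertices with a blue `2`-edge. -/
def M (σ : State E T₁ T₂) : Set V := markSet Z.at₂ σ.2.2 false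

/-- `Mt`: the vertices with a red `2`-edge. -/
def Mt (σ : State E T₁ T₂) : Set V := markSet Z.at₂ σ.2.2 true

/-! ## The zone sets of §12 with a protected anchor set `Q` -/

/-- `P`: the blue reach of the protected anchors (their sub-zones). -/
def P (Q : Set V) (σ : State E T₁ T₂) : Set V := reach (Z.BlueAdj σ) Q

/-- `Γ`: the sub-zones of the protected anchors carry no blue terminal edge. -/
def Gam (Q : Set V) (σ : State E T₁ T₂) : Prop := Disjoint (Z.P Q σ) (Z.Bl σ ∪ Z.M σ)

/-- `D`: the deleted vertices (the blue reach of the blockers). -/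
def D (σ : State E T₁ T₂) : Set V := reach (Z.BlueAdj σ) (Z.Bl σ)

/-- `K`: the red reach of the anchors. -/
def K (A : Set V) (σ : State E T₁ T₂) : Set V := reach (Z.RedAdj σ) A

/-- `REACH`: the red reach of the non-deleted anchors inside the non-deleted vertices. -/
def REACH (A : Set V) (σ : State E T₁ T₂) : Set V := reachIn (Z.RedAdj σ) (Z.D σ)ᶜ A

/-- `C`: the mixed reach of the anchors relative to `P`. -/
def Cmix (Q A : Set V) (σ : State E T₁ T₂) : Set V := reach (Z.MixedAdj (Z.P Q σ) σ) A

/-- Admissible: no sub-zone carries both a blue `1`-edge and a blue `2`-edge. -/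
def adm (σ : State E T₁ T₂) : Prop := Disjoint (Z.M σ) (Z.D σ)

/-- Blue at `K`: no red terminal edge at a vertex of `K`. -/
def blueK (A : Set V) (σ : State E T₁ T₂) : Prop := Disjoint (Z.K A σ) (Z.Blt σ ∪ Z.Mt σ)

/-- Some anchor is deleted. -/
def anchorDel (A : Set V) (σ : State E T₁ T₂) : Prop := (A ∩ Z.D σ).Nonempty

/-- No red `2`-edge at a vertex of `REACH`. -/
def reach2 (A : Set V) (σ : State E T₁ T₂) : Prop := Disjoint (Z.REACH A σ) (Z.Mt σ)

section Sets

variable [Fintype E] [DecidableEq E] [Fintype T₁] [DecidableEq T₁] [Fintype T₂] [DecidableEq T₂] (Q A : Set V)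

open Classical in
/-- `𝓛_Z`: admissible, blue at `K`, some anchor deleted (with `Γ`). -/
noncomputable def Lset : Finset (State E T₁ T₂) :=
  univ.filter fun σ => Z.adm σ ∧ Z.blueK A σ ∧ Z.anchorDel A σ ∧ Z.Gam Q σ

open Classical in
/-- `𝓡_Z`: admissible, no anchor deleted, no red `2`-edge at `REACH`, a red terminal edge at `K` (with `Γ`). -/
noncomputable def Rset : Finset (State E T₁ T₂) :=
  univ.filter fun σ => Z.adm σ ∧ ¬ Z.anchorDel A σ ∧ Z.reach2 A σ ∧ ¬ Z.blueK A σ ∧ Z.Gam Q σ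

open Classical in
/-- `Κ`: admissible, blue at `K` (with `Γ`). -/
noncomputable def Kset : Finset (State E T₁ T₂) :=
  univ.filter fun σ => Z.adm σ ∧ Z.blueK A σ ∧ Z.Gam Q σ

open Classical in
/-- `Ρ′`: admissible, no anchor deleted, no red `2`-edge at `REACH` (with `Γ`). -/
noncomputable def Pset : Finset (State E T₁ T₂) :=
  univ.filter fun σ => Z.adm σ ∧ ¬ Z.anchorDel A σ ∧ Z.reach2 A σ ∧ Z.Gam Q σ

open Classical in
/-- `W`: the common remainder — admissible, no anchor deleted, blue at `K` (with `Γ`). -/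
noncomputable def Wset : Finset (State E T₁ T₂) :=
  univ.filter fun σ => Z.adm σ ∧ ¬ Z.anchorDel A σ ∧ Z.blueK A σ ∧ Z.Gam Q σ

open Classical in
/-- `K2`: the image of `Κ` under the first dual (STEP 2). -/
noncomputable def K2set : Finset (State E T₁ T₂) :=
  univ.filter fun σ => Disjoint (Z.M σ) (reachIn (Z.RedAdj σ) (Z.P Q σ)ᶜ (Z.Blt σ)) ∧
    Disjoint (Z.Cmix Q A σ) (Z.Bl σ ∪ Z.Mt σ ∪ (Z.Blt σ ∩ Z.P Q σ)) ∧ Z.Gam Q σ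

open Classical in
/-- `P2`: the set between the comparison (STEP 3) and `Ρ′` (STEP 1). -/
noncomputable def P2set : Finset (State E T₁ T₂) :=
  univ.filter fun σ => Z.adm σ ∧ Disjoint (Z.Cmix Q A σ) (Z.Bl σ ∪ Z.Mt σ) ∧ Z.Gam Q σ

end Sets

/-! ## The involutions -/

open Classical in
/-- Complement the colours of the edges not touching `X`. -/
noncomputable def flipCol (X : Set V) (c : E → Bool) : E → Bool := fun e =>
  if Z.Touches X e then c e else !c e

/-- An edge touching `X` keeps its colour. -/
theorem flipCol_of_touches (X : Set V) (c : E → Bool) {e : E} (h : Z.Touches X e) : Z.flipCol X c e = c e := by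
  unfold flipCol
  rw [if_pos h]

/-- An edge not touching `X` is complemented. -/
theorem flipCol_of_not_touches (X : Set V) (c : E → Bool) {e : E} (h : ¬ Z.Touches X e) :
    Z.flipCol X c e = !c e := by
  unfold flipCol
  rw [if_neg h]

/-- The complement is an involution. -/
theorem flipCol_flipCol (X : Set V) (c : E → Bool) : Z.flipCol X (Z.flipCol X c) = c := by
  funext e
  by_cases h : Z.Touches X e
  · rw [Z.flipCol_of_touches X _ h, Z.flipCol_of_touches X c h]
  · rw [Z.flipCol_of_not_touches X _ h, Z.flipCol_of_not_touches X c h, Bool.not_not]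

/-- The state with the edges not touching `X` complemented. -/
noncomputable def flipOut (X : Set V) (σ : State E T₁ T₂) : State E T₁ T₂ := (Z.flipCol X σ.1, σ.2.1, σ.2.2)

/-- The state with the edges not touching `X` complemented and the `1`-patterns outside `X` swapped. -/
noncomputable def dual (X : Set V) (σ : State E T₁ T₂) : State E T₁ T₂ :=
  (Z.flipCol X σ.1, swapMark Z.at₁ X σ.2.1, σ.2.2)

/-- `flipOut X` is an involution. -/
theorem flipOut_flipOut (X : Set V) (σ : State E T₁ T₂) : Z.flipOut X (Z.flipOut X σ) = σ := by
  obtain ⟨c, m₁, m₂⟩ := σ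
  simp only [flipOut, Z.flipCol_flipCol]

/-- `dual X` is an involution. -/
theorem dual_dual (X : Set V) (σ : State E T₁ T₂) : Z.dual X (Z.dual X σ) = σ := by
  obtain ⟨c, m₁, m₂⟩ := σ
  simp only [dual, Z.flipCol_flipCol, swapMark_swapMark]

/-- An involution is injective. -/
theorem injective_of_involutive {α : Type*} (f : α → α) (hf : ∀ x, f (f x) = x) : Function.Injective f := by
  intro x y hxy
  rw [← hf x, hxy, hf y]

/-- `flipOut X` is injective. -/
theorem flipOut_injective (X : Set V) : Function.Injective (Z.flipOut X) :=
  injective_of_involutive _ (Z.flipOut_flipOut X)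

/-- `dual X` is injective. -/
theorem dual_injective (X : Set V) : Function.Injective (Z.dual X) :=
  injective_of_involutive _ (Z.dual_dual X)

/-! ## Marks of the images -/

/-- The complement does not change the marks. -/
theorem Bl_flipOut (X : Set V) (σ : State E T₁ T₂) : Z.Bl (Z.flipOut X σ) = Z.Bl σ := rfl
/-- The complement does not change the marks. -/
theorem Blt_flipOut (X : Set V) (σ : State E T₁ T₂) : Z.Blt (Z.flipOut X σ) = Z.Blt σ := rfl
/-- The complement does not change the marks. -/
theorem M_flipOut (X : Set V) (σ : State E T₁ T₂) : Z.M (Z.flipOut X σ) = Z.M σ := rfl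
/-- The complement does not change the marks. -/
theorem Mt_flipOut (X : Set V) (σ : State E T₁ T₂) : Z.Mt (Z.flipOut X σ) = Z.Mt σ := rfl
/-- The dual does not change the `2`-marks. -/
theorem M_dual (X : Set V) (σ : State E T₁ T₂) : Z.M (Z.dual X σ) = Z.M σ := rfl
/-- The dual does not change the `2`-marks. -/
theorem Mt_dual (X : Set V) (σ : State E T₁ T₂) : Z.Mt (Z.dual X σ) = Z.Mt σ := rfl

/-- Inside `X` the dual keeps the blue `1`-marks. -/
theorem mem_Bl_dual_of_mem (X : Set V) (σ : State E T₁ T₂) {v : V} (hv : v ∈ X) :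
    v ∈ Z.Bl (Z.dual X σ) ↔ v ∈ Z.Bl σ :=
  mem_markSet_swapMark_of_mem Z.at₁ X σ.2.1 false hv

/-- Inside `X` the dual keeps the red `1`-marks. -/
theorem mem_Blt_dual_of_mem (X : Set V) (σ : State E T₁ T₂) {v : V} (hv : v ∈ X) :
    v ∈ Z.Blt (Z.dual X σ) ↔ v ∈ Z.Blt σ :=
  mem_markSet_swapMark_of_mem Z.at₁ X σ.2.1 true hv

/-- Outside `X` the blue `1`-marks of the dual are the red `1`-marks of the state. -/
theorem mem_Bl_dual_of_not_mem (X : Set V) (σ : State E T₁ T₂) {v : V} (hv : v ∉ X) :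
    v ∈ Z.Bl (Z.dual X σ) ↔ v ∈ Z.Blt σ :=
  mem_markSet_swapMark_of_not_mem Z.at₁ X σ.2.1 false hv

/-- Outside `X` the red `1`-marks of the dual are the blue `1`-marks of the state. -/
theorem mem_Blt_dual_of_not_mem (X : Set V) (σ : State E T₁ T₂) {v : V} (hv : v ∉ X) :
    v ∈ Z.Blt (Z.dual X σ) ↔ v ∈ Z.Bl σ :=
  mem_markSet_swapMark_of_not_mem Z.at₁ X σ.2.1 true hv

/-! ## Colours of the images -/

/-- The dual keeps the colour of an edge touching `X`. -/
theorem dual_fst_of_touches (X : Set V) (σ : State E T₁ T₂) {e : E} (h : Z.Touches X e) :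
    (Z.dual X σ).1 e = σ.1 e :=
  Z.flipCol_of_touches X σ.1 h

/-- The dual complements an edge not touching `X`. -/
theorem dual_fst_of_not_touches (X : Set V) (σ : State E T₁ T₂) {e : E} (h : ¬ Z.Touches X e) :
    (Z.dual X σ).1 e = !σ.1 e :=
  Z.flipCol_of_not_touches X σ.1 h

/-- The complement keeps the colour of an edge touching `X`. -/
theorem flipOut_fst_of_touches (X : Set V) (σ : State E T₁ T₂) {e : E} (h : Z.Touches X e) :
    (Z.flipOut X σ).1 e = σ.1 e :=
  Z.flipCol_of_touches X σ.1 h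

/-- The complement complements an edge not touching `X`. -/
theorem flipOut_fst_of_not_touches (X : Set V) (σ : State E T₁ T₂) {e : E} (h : ¬ Z.Touches X e) :
    (Z.flipOut X σ).1 e = !σ.1 e :=
  Z.flipCol_of_not_touches X σ.1 h

end ZoneData

end ZoneZ

end PercRepro
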